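import Mathlib
import Literature.AlgebraicGeometry.Resolution.DivisorialPart
import Literature.AlgebraicGeometry.Morphisms.CechModule
import Literature.AlgebraicGeometry.Motives.CartierDivisor
import HarnessLib

/-!
# Route `HomologicalConductor`, crux `NoZenoR` (stmt-ResolutionOfSingularities-19943; twin `NoZeno`
# stmt-16483), S3 G-layer, G1 = LEMMA L (sheaf half) — part 2/3: the base ideal sheaf `𝔞𝒪_X`,
# orders along codimension-one points, and the divisorial part

OURS (cell res-hironaka, crux chain W4.4, seat res-L0-w44-stub-2). Nothing here is a statement of the
manuscript under review (Hironaka 2017); AI-written, weaker than expert review.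

For `π : X → Spec T` and an ideal `𝔞 ⊆ T`:

* `stalkIdeal_ofIdealTop_map`, `stalkIdeal_ofIdealTop_map_eq_top_of_base_ne` — the stalks of
  `𝔞𝒪_X = ofIdealTop (𝔞Γ(X, 𝒪_X))`; off the closed fibre `𝔞𝒪_X = 𝒪_X` as soon as `𝔞 ⊇ 𝔪ᶜ`;
* `isClosed_singleton_of_one_lt_coheight`, `finite_of_isClosed_of_forall_isClosed_singleton` — on a
  scheme of dimension `≤ 2` the points of codimension `≥ 2` are closed, and a closed set of closed
  points of a Noetherian sober space is finite (so `V(J)` of the codimension-two part is finite);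
* `natCast_le_ord_toFunctionField_iff`, `natCast_le_ord_germ_iff` — **`n ≤ ord_ζ(g) ↔ g_ζ ∈ 𝔪_ζⁿ`**
  at a point whose local ring is a discrete valuation ring (Mathlib `Scheme.ord`, `Ring.ord`);
* `le_divisorialPart_of_forall_stalkIdeal_le` — **an ideal sheaf `K` with `K_ζ ⊆ 𝔪_ζ^{ord_ζ I}` at
  every codimension-one point `ζ` of `V(I)` lies below the divisorial part `∏ 𝓘_{E_ζ}^{ord_ζ I}` of
  `I`** (regular `X`; the argument of the tree's `Resolution/DivisorialPart.le_divisorialPart`,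
  Cossart–Piltant 2008 Prop. 4.2, for an arbitrary `K`).

Consumed by part 3/3 (`…NoZenoAnnihilatorLemmaL`). References: V. Cossart, O. Piltant, J. Algebra 320
(2008) Prop. 4.2 [`CossartPiltant2008`]; U. Görtz, T. Wedhorn, *Algebraic Geometry I* Thm. 11.40
[`GortzWedhorn2020`].
-/

noncomputable section

-- single-problem summit: the doubled namespace component `ResolutionOfSingularities` is forced
set_option linter.dupNamespace false

open CategoryTheory CategoryTheory.Limits AlgebraicGeometry TopologicalSpace Opposite IsLocalRing
open Literature.AlgebraicGeometry.Resolution Literature.AlgebraicGeometry.Morphisms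

namespace Summit.ResolutionOfSingularities.ResolutionOfSingularities.Theorems.NoZeno.SandwichCluster.LemmaL

universe u

/-! ## The ideal sheaf `𝔞𝒪_X` of an ideal of the base -/

section BaseIdeal

variable {T : Type u} [CommRing T] {X : Scheme.{u}} (π : X ⟶ Spec (.of T))

/-- The stalk of `𝔞𝒪_X = ofIdealTop (𝔞 Γ(X, 𝒪_X))` at `x` is generated by the germs of `𝔞`
under the structure map `T → Γ(X, 𝒪_X) → 𝒪_{X,x}`. [folklore] -/
theorem stalkIdeal_ofIdealTop_map (𝔞 : Ideal T) (x : X) :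
    stalkIdeal (Scheme.IdealSheafData.ofIdealTop (𝔞.map (algebraMapΓ π))) x =
      𝔞.map ((X.presheaf.germ ⊤ x trivial).hom.comp (algebraMapΓ π)) := by
  obtain ⟨U, hU, hxU, -⟩ :=
    exists_isAffineOpen_mem_and_subset (X := X) (x := x) (U := ⊤) (Opens.mem_top x)
  rw [stalkIdeal_eq_map_germ _ ⟨U, hU⟩ hxU, Scheme.IdealSheafData.ofIdealTop_ideal, Ideal.map_map,
    Ideal.map_map]
  congr 2
  rw [← CommRingCat.hom_comp, TopCat.Presheaf.germ_res X.presheaf (homOfLE (le_top : U ≤ ⊤)) x hxU]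

/-- The germ of `t ∈ T` at `x ∈ X` along `π` is the image under `𝒪_{Spec T, π x} → 𝒪_{X, x}` of the
germ of `t` on `Spec T`. [folklore] -/
theorem germ_algebraMapΓ_eq_stalkMap (t : T) (x : X) :
    (X.presheaf.germ ⊤ x trivial).hom (algebraMapΓ π t) =
      (π.stalkMap x).hom ((StructureSheaf.toStalk T (π.base x)).hom t) :=
  (Scheme.Hom.germ_stalkMap_apply π ⊤ x trivial ((Scheme.ΓSpecIso (.of T)).inv.hom t)).symm

/-- **Off the closed fibre, `𝔞𝒪_X` is the unit ideal** as soon as `𝔞 ⊇ 𝔪ᶜ` (`T` local): at a point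
`x` with `π x ≠ 𝔪` some `s ∈ 𝔪` is a unit in `𝒪_{X,x}`, hence so is `s^c ∈ 𝔞`. [folklore] -/
theorem stalkIdeal_ofIdealTop_map_eq_top_of_base_ne [IsLocalRing T] {𝔞 : Ideal T} {c : ℕ}
    (hc : maximalIdeal T ^ c ≤ 𝔞) {x : X} (hx : π.base x ≠ closedPoint T) :
    stalkIdeal (Scheme.IdealSheafData.ofIdealTop (𝔞.map (algebraMapΓ π))) x = ⊤ := by
  -- a function `s ∈ 𝔪 ∖ 𝔭`, `𝔭 = π x`
  have hne : (π.base x).asIdeal ≠ maximalIdeal T := fun h =>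
    hx (PrimeSpectrum.ext (h.trans rfl))
  have hle : (π.base x).asIdeal ≤ maximalIdeal T := IsLocalRing.le_maximalIdeal (π.base x).2.ne_top
  obtain ⟨s, hs𝔪, hs𝔭⟩ : ∃ s ∈ maximalIdeal T, s ∉ (π.base x).asIdeal := by
    by_contra h
    push Not at h
    exact hne (le_antisymm hle h)
  have hunit0 : IsUnit ((StructureSheaf.toStalk T (π.base x)).hom s) := by
    have h0 := IsLocalization.map_units ((Spec.structureSheaf T).presheaf.stalk (π.base x))
      (⟨s, hs𝔭⟩ : (π.base x).asIdeal.primeCompl)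
    rwa [StructureSheaf.stalkAlgebra_map] at h0
  have hunit : IsUnit ((X.presheaf.germ ⊤ x trivial).hom (algebraMapΓ π s)) := by
    rw [germ_algebraMapΓ_eq_stalkMap]
    exact hunit0.map (π.stalkMap x).hom
  rw [stalkIdeal_ofIdealTop_map]
  have hsc : s ^ c ∈ 𝔞 := hc (Ideal.pow_mem_pow hs𝔪 c)
  have h1 := Ideal.mem_map_of_mem ((X.presheaf.germ ⊤ x trivial).hom.comp (algebraMapΓ π)) hsc
  rw [map_pow] at h1
  exact Ideal.eq_top_of_isUnit_mem _ h1 (hunit.pow c)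

end BaseIdeal

/-! ## Points of codimension `≥ 2` on a scheme of dimension `≤ 2` are closed; finiteness -/

section Codim

variable {X : Scheme.{u}}

/-- On a scheme all of whose points have codimension `≤ 2`, a point of codimension `> 1` is a closed
point. [folklore] -/
theorem isClosed_singleton_of_one_lt_coheight (hdim : ∀ x : X, Order.coheight x ≤ 2) {x : X}
    (hx : 1 < Order.coheight x) : IsClosed ({x} : Set X) := by
  have hcl : closure ({x} : Set X) = {x} := by
    ext y
    rw [← specializes_iff_mem_closure, Set.mem_singleton_iff]
    constructor
    · intro hxy
      by_contra hne
      have hlt : y < x := lt_of_le_not_ge (Scheme.le_iff_specializes.mpr hxy) fun h' =>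
        hne ((Specializes.antisymm (Scheme.le_iff_specializes.mp h') hxy).eq)
      have h1 := Order.coheight_add_one_le hlt
      have h2 := hdim y
      have hxfin : Order.coheight x ≠ ⊤ := ne_top_of_le_ne_top (by decide) (hdim x)
      obtain ⟨c, hc⟩ := ENat.ne_top_iff_exists.mp hxfin
      rw [← hc] at h1 hx
      have hyfin : Order.coheight y ≠ ⊤ := ne_top_of_le_ne_top (by decide) h2
      obtain ⟨d, hd⟩ := ENat.ne_top_iff_exists.mp hyfin
      rw [← hd] at h1 h2
      have e1 : c + 1 ≤ d := by exact_mod_cast h1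
      have e2 : d ≤ 2 := by exact_mod_cast h2
      have e3 : 1 < c := by exact_mod_cast hx
      omega
    · rintro rfl
      exact specializes_rfl
  rw [← hcl]
  exact isClosed_closure

/-- **A closed subset of a Noetherian sober space all of whose points are closed is finite** (it is a
finite union of irreducible closed subsets, each the closure of its generic point). [folklore] -/
theorem finite_of_isClosed_of_forall_isClosed_singleton [NoetherianSpace X] {S : Set X}
    (hS : IsClosed S) (h : ∀ x ∈ S, IsClosed ({x} : Set X)) : S.Finite := by
  obtain ⟨C, hCfin, hCcl, hCirr, rfl⟩ := NoetherianSpace.exists_finite_set_isClosed_irreducible hS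
  rw [Set.sUnion_eq_biUnion]
  refine hCfin.biUnion fun t ht => ?_
  -- each irreducible closed piece is a singleton
  obtain ⟨x, hxt⟩ := QuasiSober.sober (hCirr t ht) (hCcl t ht)
  have hxS : x ∈ ⋃₀ C := Set.mem_sUnion.mpr ⟨t, ht, hxt.mem⟩
  have ht1 : t = {x} := by
    refine Set.Subset.antisymm (fun y hy => ?_) (Set.singleton_subset_iff.mpr hxt.mem)
    have hxy : x ⤳ y := hxt.specializes hy
    rw [specializes_iff_mem_closure, (h x hxS).closure_eq] at hxy
    exact hxy
  rw [ht1]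
  exact Set.finite_singleton x

end Codim

/-! ## Orders along a codimension-one point: `n ≤ ord_ζ(g) ↔ g_ζ ∈ 𝔪_ζⁿ` -/

section Ord

variable {X : Scheme.{u}} [IsIntegral X] [IsLocallyNoetherian X]

/-- In a discrete valuation ring, `u·ϖᵏ ∈ 𝔪ⁿ ↔ n ≤ k`. [folklore] -/
theorem unit_mul_pow_mem_maximalIdeal_pow_iff {R : Type*} [CommRing R] [IsDomain R]
    [IsDiscreteValuationRing R] {ϖ : R} (hϖ : Irreducible ϖ) (u : Rˣ) (k n : ℕ) :
    (u : R) * ϖ ^ k ∈ maximalIdeal R ^ n ↔ n ≤ k := by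
  rw [hϖ.maximalIdeal_eq, Ideal.span_singleton_pow, Ideal.mem_span_singleton, u.isUnit.dvd_mul_left,
    pow_dvd_pow_iff hϖ.ne_zero hϖ.not_isUnit]

/-- **`n ≤ ord_ζ(g)` iff the germ of `g` lies in `𝔪_ζⁿ`**, for a point `ζ` whose local ring is a
discrete valuation ring (a codimension-one point of a regular scheme) and a germ `g ≠ 0`.
[folklore] -/
theorem natCast_le_ord_toFunctionField_iff {ζ : X} (hζ : Order.coheight ζ = 1)
    [IsDiscreteValuationRing (X.presheaf.stalk ζ)] {g : X.presheaf.stalk ζ} (hg : g ≠ 0) (n : ℕ) :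
    (n : ℤ) ≤ Scheme.ord (Literature.AlgebraicGeometry.Motives.RatFn.toFunctionField ζ g) ζ ↔
      g ∈ maximalIdeal (X.presheaf.stalk ζ) ^ n := by
  obtain ⟨ϖ, hϖ⟩ := IsDiscreteValuationRing.exists_irreducible (X.presheaf.stalk ζ)
  obtain ⟨k, u, rfl⟩ := IsDiscreteValuationRing.eq_unit_mul_pow_irreducible hg hϖ
  rw [unit_mul_pow_mem_maximalIdeal_pow_iff hϖ u k n]
  -- `ord_ζ (u ϖ^k) = k`
  haveI : Ring.KrullDimLE 1 (X.presheaf.stalk ζ) := krullDimLE_of_coheight_le hζ.le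
  have hϖ0 : ϖ ∈ nonZeroDivisors (X.presheaf.stalk ζ) := mem_nonZeroDivisors_of_ne_zero hϖ.ne_zero
  have hg' : (u : X.presheaf.stalk ζ) * ϖ ^ k ∈ nonZeroDivisors (X.presheaf.stalk ζ) :=
    mem_nonZeroDivisors_of_ne_zero hg
  have hord : Ring.ord (X.presheaf.stalk ζ) ((u : X.presheaf.stalk ζ) * ϖ ^ k) = k := by
    rw [Ring.ord_mul_of_isUnit_left u.isUnit, Ring.ord_pow hϖ0, Ring.ord_of_irreducible hϖ]
    simp
  have h0 : Literature.AlgebraicGeometry.Motives.RatFn.toFunctionField ζ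
      ((u : X.presheaf.stalk ζ) * ϖ ^ k) ≠ 0 :=
    (map_ne_zero_iff _ (Literature.AlgebraicGeometry.Motives.RatFn.toFunctionField_injective ζ)).mpr hg
  have key : Scheme.ord (Literature.AlgebraicGeometry.Motives.RatFn.toFunctionField ζ
      ((u : X.presheaf.stalk ζ) * ϖ ^ k)) ζ = k := by
    rw [Scheme.ord_eq_iff hζ h0]
    change Ring.ordFrac (X.presheaf.stalk ζ) (algebraMap _ X.functionField _) = _
    rw [Ring.ordFrac_eq_ord _ hg, Ring.ordMonoidWithZeroHom_eq_coe _ hg' hord]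
  rw [key]
  exact_mod_cast Iff.rfl

/-- The same for a global section `g` at `ζ`, the rational function being its germ at the generic
point: `n ≤ ord_ζ(g) ↔ (g)·𝒪_{X,ζ} ⊆ 𝔪_ζⁿ`. [folklore] -/
theorem natCast_le_ord_germ_iff {ζ : X} (hζ : Order.coheight ζ = 1)
    [IsDiscreteValuationRing (X.presheaf.stalk ζ)] {g : Γ(X, ⊤)}
    (hg : (X.presheaf.germ ⊤ ζ trivial).hom g ≠ 0) (n : ℕ) :
    (n : ℤ) ≤ Scheme.ord ((X.presheaf.germ ⊤ (genericPoint X) trivial).hom g) ζ ↔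
      Ideal.span {(X.presheaf.germ ⊤ ζ trivial).hom g} ≤ maximalIdeal (X.presheaf.stalk ζ) ^ n := by
  rw [Ideal.span_singleton_le_iff_mem, ← natCast_le_ord_toFunctionField_iff hζ hg n]
  have e := Literature.AlgebraicGeometry.Motives.RatFn.toFunctionField_germ
    (X := X) (x := ζ) (U := ⊤) trivial g
  rw [e]

end Ord

/-! ## An ideal sheaf below every `𝓘_{E_i}^{a(i)}` is below the divisorial part -/

section DivisorialPart

variable {X : Scheme.{u}} [IsIntegral X] [IsNoetherian X]

/-- **`K ⊆ H = ∏ 𝓘_{E_i}^{a(i)}` as soon as `K_{ζ_i} ⊆ 𝔪_{ζ_i}^{a(i)}` at every codimension-one point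
`ζ_i` of `V(I)`** (`a(i) = ord_{ζ_i} I`; regular `X`: in the factorial `𝒪_{X,x}` the pairwise
non-associated primes `p_i` of the `ζ_i ⤳ x` satisfy `p_i^{a(i)} ∣ f ⇒ ∏ p_i^{a(i)} ∣ f`).
[cite: CossartPiltant2008, proof of Prop. 4.2] -/
theorem le_divisorialPart_of_forall_stalkIdeal_le (hX : Scheme.IsRegular X) {I : X.IdealSheafData}
    (hI : I ≠ ⊥) {K : X.IdealSheafData}
    (hK : ∀ ζ ∈ divisorialPoints I,
      stalkIdeal K ζ ≤ maximalIdeal (X.presheaf.stalk ζ) ^ (idealOrder I ζ).toNat) :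
    K ≤ divisorialPart I := by
  classical
  refine le_of_forall_stalkIdeal_le fun x => ?_
  haveI := hX.uniqueFactorizationMonoid_stalk x
  set T := (finite_divisorialPoints hI).toFinset with hT
  have hTmem : ∀ ζ ∈ T, ζ ∈ divisorialPoints I := fun ζ h => (Set.Finite.mem_toFinset _).mp h
  -- prime generators of `𝔭_ζ` for the generisations `ζ ⤳ x` in `T`
  have hq : ∀ ζ : {ζ // ζ ∈ T ∧ ζ ⤳ x}, ∃ q : X.presheaf.stalk x,
      Prime q ∧ primeOfSpecializes ζ.2.2 = Ideal.span {q} :=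
    fun ζ => exists_prime_primeOfSpecializes_eq_span ζ.2.2 (hTmem ζ ζ.2.1).2
  choose q hqprime hqspan using hq
  let q' : X → X.presheaf.stalk x := fun ζ => if h : ζ ∈ T ∧ ζ ⤳ x then q ⟨ζ, h⟩ else 1
  have hq'_pos : ∀ (ζ : X) (h : ζ ∈ T ∧ ζ ⤳ x), q' ζ = q ⟨ζ, h⟩ := fun ζ h => dif_pos h
  have hq'_neg : ∀ ζ : X, ¬ ζ ⤳ x → q' ζ = 1 := fun ζ h => dif_neg fun hh => h hh.2
  have hstalk : ∀ ζ ∈ T, stalkIdeal (primeDivisorIdeal ζ) x = Ideal.span {q' ζ} := by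
    intro ζ hζ
    by_cases h : ζ ⤳ x
    · rw [hq'_pos ζ ⟨hζ, h⟩, stalkIdeal_primeDivisorIdeal h]
      exact hqspan ⟨ζ, hζ, h⟩
    · rw [hq'_neg ζ h, stalkIdeal_primeDivisorIdeal_eq_top h, Ideal.span_singleton_one]
  have hH : stalkIdeal (divisorialPart I) x = Ideal.span {∏ ζ ∈ T, q' ζ ^ (idealOrder I ζ).toNat} := by
    rw [divisorialPart_eq (finite_divisorialPoints hI), stalkIdeal_finset_prod,
      ← Ideal.prod_span_singleton]
    refine Finset.prod_congr rfl fun ζ hζ => ?_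
    rw [stalkIdeal_pow, hstalk ζ hζ, Ideal.span_singleton_pow]
  rw [hH]
  intro f hf
  rw [Ideal.mem_span_singleton]
  -- only the generisations of `x` contribute
  have hsplit : ∏ ζ ∈ T, q' ζ ^ (idealOrder I ζ).toNat =
      ∏ ζ ∈ T.filter (· ⤳ x), q' ζ ^ (idealOrder I ζ).toNat := by
    rw [Finset.prod_filter]
    refine Finset.prod_congr rfl fun ζ _ => ?_
    split_ifs with h
    · rfl
    · rw [hq'_neg ζ h, one_pow]
  rw [hsplit]
  refine Finset.prod_pow_dvd_of_forall_pow_dvd q' _ _ ?_ ?_ ?_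
  · intro ζ hζ
    obtain ⟨hζT, h⟩ := Finset.mem_filter.mp hζ
    rw [hq'_pos ζ ⟨hζT, h⟩]
    exact hqprime _
  · intro ζ hζ ζ' hζ' hne hdvd
    obtain ⟨hζT, h⟩ := Finset.mem_filter.mp hζ
    obtain ⟨hζ'T, h'⟩ := Finset.mem_filter.mp hζ'
    have hle : primeOfSpecializes h' ≤ primeOfSpecializes h := by
      rw [hqspan ⟨ζ, hζT, h⟩, hqspan ⟨ζ', hζ'T, h'⟩, ← hq'_pos ζ ⟨hζT, h⟩,
        ← hq'_pos ζ' ⟨hζ'T, h'⟩]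
      exact Ideal.span_singleton_le_span_singleton.mpr hdvd
    exact not_specializes_of_coheight_eq_one (hTmem ζ' hζ'T).2 (hTmem ζ hζT).2 (Ne.symm hne)
      (specializes_of_primeOfSpecializes_le h h' hle)
  · intro ζ hζ
    obtain ⟨hζT, -⟩ := Finset.mem_filter.mp hζ
    have h1 : f ∈ stalkIdeal (primeDivisorIdeal ζ ^ (idealOrder I ζ).toNat) x :=
      stalkIdeal_mono (le_primeDivisorIdeal_pow_of_isRegular hX (hTmem ζ hζT).2
        (hK ζ (hTmem ζ hζT))) x hf
    rw [stalkIdeal_pow, hstalk ζ hζT, Ideal.span_singleton_pow, Ideal.mem_span_singleton] at h1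
    exact h1

end DivisorialPart

end Summit.ResolutionOfSingularities.ResolutionOfSingularities.Theorems.NoZeno.SandwichCluster.LemmaL

end
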